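import Mathlib.LinearAlgebra.Matrix.Block
import Mathlib.LinearAlgebra.Matrix.Determinant.Basic
import Mathlib.LinearAlgebra.Matrix.RowCol
import Mathlib.RingTheory.Ideal.Span

/-!
# Venture HSemireg — the block frame of a corank-one degeneracy locus: the maximal minors of `[[1, 0], [0, g]]`
# span exactly the ideal `(g₁, …, g_n)` (kernel step of ATTEMPT-7 (γ′)(b))

HONEST FRAMING.  Part of the Lean side of the computation cell `pub-hsemireg` (track «S4-PUSH» (ii), lane pen s4-prove-1
g6, note `run/shared/lean/pub/pub-hsemireg/s4push/prove-1/ATTEMPT-7.md` §2 (γ′)(b)).  In the every-`φ` form of THEOREM N″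
(ATTEMPT-5 / `PorteousConfinement.lean`; ATTEMPT-7 §3) the set-up products are derived from «`Z = D_{e−1}(φ)` scheme-smooth
of pure dimension `n`»: once `D_{e−2}(φ) = ∅` (ATTEMPT-7 (γ′)(a); kernel `PorteousShapesRegularity.lean`), row and column
operations over the local ring `𝒪_{A,p}` bring the matrix of `φ` to the BLOCK FRAME `[[1_{e−1}, 0], [0, g]]` with `g` a
single row of `n = f − e + 1` functions, and the claim used downstream is that the Fitting ideal of `D_{e−1}` — the ideal
of the `e × e` minors — is exactly `(g₁, …, g_n)`.  This file kernel-checks that matrix statement over any commutative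
ring `A`, with the minors in the convention of `PorteousShapes.lean` (determinants of `submatrix rows cols` for ARBITRARY
selections `rows, cols : Fin (k+1) → _`, `k = card r` where `r` indexes the identity block):

* `det_submatrix_blockRow_mem` — every `(k+1) × (k+1)` minor with `k ≥ card r` lies in `Ideal.span (range g)`: either two
  selected rows coincide (determinant `0`) or the selection is injective, hence hits the `g`-row, along which we expand
  (`Matrix.det_succ_row`), every entry of that row being `0` or some `g j`;
* `det_submatrix_blockRow_eq` — conversely each `g j` IS such a minor (all rows, columns `r ⊕ {j}`: the block
  `[[1, 0], [0, (g j)]]`, determinant `g j`);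
* `span_minors_blockRow_eq` — hence the ideal of maximal minors EQUALS `Ideal.span (range g)`.

NOT LEAN (paper, ATTEMPT-7 §2): the existence of the block frame (an invertible `(e−1) × (e−1)` minor at a point of
`D_{e−1} ∖ D_{e−2}` and Gaussian elimination over the local ring), the invariance of Fitting ideals under row/column
operations, «`n` generators of a height-`n` ideal in a Cohen–Macaulay local ring form a regular sequence» (Fulton,
Intersection Theory, Lemma A.7.1 as printed), and everything geometric.  Nothing here constructs a variety, a degeneracy
locus or a Weil class; nothing here says that HC / HC_CM / HC_AV holds; no Literature fact is declared; NEGATIVE #12's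
signed text does not move.
-/

namespace Summit.Ventures.HSemireg.PorteousShapes

open Matrix

variable {A : Type*} [CommRing A] {r n : Type*} [DecidableEq r]

/-- Every entry of the last row of the block matrix `[[1_r, 0], [0, g]]` (rows `r ⊕ Unit`, columns `r ⊕ n`, `g` the single
last row) is `0` or an entry of `g`, hence lies in the ideal spanned by the entries of `g`. -/
theorem blockRow_inr_mem (g : n → A) (c : r ⊕ n) :
    (Matrix.fromBlocks (1 : Matrix r r A) 0 0 (Matrix.of fun (_ : Unit) j => g j)) (Sum.inr ()) c
      ∈ Ideal.span (Set.range g) := by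
  rcases c with c | j
  · simp
  · simp only [fromBlocks_apply₂₂, of_apply]
    exact Ideal.subset_span ⟨j, rfl⟩

/-- **Maximal minors of the block frame lie in `(g₁, …, g_n)`.**  Every `(k+1) × (k+1)` minor (determinant of
`submatrix rows cols`, ARBITRARY selections) of `[[1_r, 0], [0, g]]` with `k ≥ card r` lies in `Ideal.span (range g)`:
either two selected rows coincide (determinant `0`), or the row selection is injective and then — `Fin (k+1)` does not
inject into `r` — it hits the `g`-row, along which we expand. -/
theorem det_submatrix_blockRow_mem [Fintype r] (g : n → A) {k : ℕ} (rows : Fin (k + 1) → r ⊕ Unit)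
    (cols : Fin (k + 1) → r ⊕ n) (hk : Fintype.card r ≤ k) :
    ((Matrix.fromBlocks (1 : Matrix r r A) 0 0 (Matrix.of fun (_ : Unit) j => g j)).submatrix rows cols).det
      ∈ Ideal.span (Set.range g) := by
  classical
  set M := Matrix.fromBlocks (1 : Matrix r r A) 0 0 (Matrix.of fun (_ : Unit) j => g j) with hM
  by_cases hinj : Function.Injective rows
  · -- some selected row is the `g`-row: otherwise `rows` injects `Fin (k+1)` into `r`, impossible
    have hex : ∃ i, rows i = Sum.inr () := by
      by_contra h
      push Not at h
      have hl : ∀ i, ∃ a, rows i = Sum.inl a := fun i => by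
        rcases hri : rows i with a | u
        · exact ⟨a, rfl⟩
        · exact absurd hri (h i)
      choose f hf using hl
      have hfinj : Function.Injective f := fun i j hij => hinj (by rw [hf i, hf j, hij])
      have hcard := Fintype.card_le_of_injective f hfinj
      simp only [Fintype.card_fin] at hcard
      omega
    obtain ⟨i, hi⟩ := hex
    rw [Matrix.det_succ_row _ i]
    refine sum_mem (fun j _ => ?_)
    have hmem : M.submatrix rows cols i j ∈ Ideal.span (Set.range g) := by
      rw [Matrix.submatrix_apply, hi, hM]
      exact blockRow_inr_mem g (cols j)
    exact Ideal.mul_mem_right _ _ (Ideal.mul_mem_left _ _ hmem)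
  · -- two equal selected rows ⇒ determinant `0`
    rw [Function.Injective] at hinj
    push Not at hinj
    obtain ⟨i, j, hij, hne⟩ := hinj
    have hdet : (M.submatrix rows cols).det = 0 :=
      Matrix.det_zero_of_row_eq hne (by ext c; simp [Matrix.submatrix_apply, hij])
    rw [hdet]
    exact Ideal.zero_mem _

/-- The square block `[[1_r, 0], [0, (g j)]]` is the submatrix of `[[1_r, 0], [0, g]]` on all rows and the columns
`r ⊕ {j}`. -/
theorem blockRow_submatrix_col (g : n → A) (j : n) :
    (Matrix.fromBlocks (1 : Matrix r r A) 0 0 (Matrix.of fun (_ : Unit) j => g j)).submatrix id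
        (Sum.map id fun (_ : Unit) => j)
      = Matrix.fromBlocks (1 : Matrix r r A) 0 0 (Matrix.of fun (_ _ : Unit) => g j) := by
  ext (a | a) (b | b) <;> simp [Matrix.submatrix_apply]

/-- **Conversely, each `g j` IS a maximal minor** of `[[1_r, 0], [0, g]]`: the determinant of the square block on the
columns `r ⊕ {j}`, reindexed by any `er : Fin (k+1) ≃ r ⊕ Unit` to match the `Fin`-indexed minors of
`PorteousShapes.lean`. -/
theorem det_submatrix_blockRow_eq [Fintype r] (g : n → A) (j : n) {k : ℕ} (er : Fin (k + 1) ≃ r ⊕ Unit) :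
    ((Matrix.fromBlocks (1 : Matrix r r A) 0 0 (Matrix.of fun (_ : Unit) j => g j)).submatrix er
        ((Sum.map id fun (_ : Unit) => j) ∘ er)).det = g j := by
  have h1 : (Matrix.fromBlocks (1 : Matrix r r A) 0 0 (Matrix.of fun (_ : Unit) j => g j)).submatrix er
        ((Sum.map id fun (_ : Unit) => j) ∘ er)
      = ((Matrix.fromBlocks (1 : Matrix r r A) 0 0 (Matrix.of fun (_ : Unit) j => g j)).submatrix id
          (Sum.map id fun (_ : Unit) => j)).submatrix er er := by
    ext a b; simp [Matrix.submatrix_apply]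
  rw [h1, Matrix.det_submatrix_equiv_self, blockRow_submatrix_col, Matrix.det_fromBlocks_zero₂₁, Matrix.det_one,
    one_mul, Matrix.det_unique]
  simp

/-- **The Fitting ideal in the block frame.**  The ideal spanned by ALL `(k+1) × (k+1)` minors (`k + 1 = card r + 1` = the
number of rows, arbitrary `Fin`-indexed selections) of `[[1_r, 0], [0, g]]` EQUALS `Ideal.span (range g)` — the matrix
content of ATTEMPT-7 (γ′)(b) «`I_{Z,p} = (g₁, …, g_n)`». -/
theorem span_minors_blockRow_eq [Fintype r] (g : n → A) {k : ℕ} (er : Fin (k + 1) ≃ r ⊕ Unit) :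
    Ideal.span (Set.range fun rc : (Fin (k + 1) → r ⊕ Unit) × (Fin (k + 1) → r ⊕ n) =>
        ((Matrix.fromBlocks (1 : Matrix r r A) 0 0 (Matrix.of fun (_ : Unit) j => g j)).submatrix rc.1 rc.2).det)
      = Ideal.span (Set.range g) := by
  have hk : Fintype.card r ≤ k := by
    have := Fintype.card_congr er
    simp only [Fintype.card_fin, Fintype.card_sum, Fintype.card_unit] at this
    omega
  apply le_antisymm
  · rw [Ideal.span_le]
    rintro _ ⟨⟨rows, cols⟩, rfl⟩
    exact det_submatrix_blockRow_mem g rows cols hk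
  · rw [Ideal.span_le]
    rintro _ ⟨j, rfl⟩
    refine Ideal.subset_span ⟨⟨er, (Sum.map id fun (_ : Unit) => j) ∘ er⟩, ?_⟩
    exact det_submatrix_blockRow_eq g j er

/-- Non-vacuity / shape check: with `r = Fin 2` (so `e = 3`, `k = 2`) and `g : Fin 4 → A` (`n = 4`, `f = 6`), the
`3 × 3` minors of the `3 × 6` block frame span `(g₀, g₁, g₂, g₃)` — an instance with honest, satisfiable hypotheses
(`er = finSumFinEquiv.symm` composed with `Fin 1 ≃ Unit`). -/
theorem span_minors_blockRow_eq_three_six (g : Fin 4 → A) :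
    Ideal.span (Set.range fun rc : (Fin 3 → Fin 2 ⊕ Unit) × (Fin 3 → Fin 2 ⊕ Fin 4) =>
        ((Matrix.fromBlocks (1 : Matrix (Fin 2) (Fin 2) A) 0 0 (Matrix.of fun (_ : Unit) j => g j)).submatrix
          rc.1 rc.2).det)
      = Ideal.span (Set.range g) :=
  span_minors_blockRow_eq g (finSumFinEquiv.symm.trans (Equiv.sumCongr (Equiv.refl _) (Equiv.ofUnique (Fin 1) Unit)))

end Summit.Ventures.HSemireg.PorteousShapes
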